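import Literature.AlgebraicGeometry.Motives.AbelianVarietyBrauerRelationInflation
import HarnessLib

/-!
# The PARABOLIC GASSMANN TRIPLE `(SL₃(𝔽₂), P₁, P₂)` (point and hyperplane stabilisers, index `7`, Perlis / L. Scott /
# Prasad), machine-checked, and its Kani–Rosen consequence: for every abelian variety with an `SL₃(𝔽₂)`-action,
# `B_{P₁} ∼ B_{P₂}` although `P₁`, `P₂` are not conjugate — ALGEBRAIC carrier, Hom counts over an arbitrary
# field, isogeny and dimensions over a perfect field

Layer A1/A2 of the Hodge foundations lane (`lit-hodgefound`, row A1-20⁺ · A2, seat p03 generation 25, row g25-#8) on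
the ALGEBRAIC carrier `AbelianVariety K` of `Motives/AbelianVariety`.  An INSTANCE, machine-checked on Mathlib's
`Matrix.SpecialLinearGroup (Fin 3) (ZMod 2)` (`168` elements; `decide`), of the Gassmann section of
`Motives/AbelianVarietyBrauerRelationIsogenies` (CONSUMED: `finrank_hom_image_eq_of_gassmann`,
`isIsogenous_of_gassmann`, `dim_eq_of_gassmann`: `|g^G ∩ H₁| = |g^G ∩ H₂|` for all `g` ⟹ `B_{H₁} ∼ B_{H₂}`) through
`Motives/AbelianVarietyBrauerRelationInflation` §1/§3 (CONSUMED: `card_isConj_eq_of_card_conj_mem_eq`,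
`isIsogenous_of_card_conj_mem_eq`: equal MARKS `|{x : x⁻¹gx ∈ H₁}| = |{x : x⁻¹gx ∈ H₂}|` suffice).  "Call a triple of
finite groups `(G, H_1, H_2)` […] a Gassmann triple, if `ℚ[G/H_1]` and `ℚ[G/H_2]` are isomorphic as `G`-modules but
`H_1` and `H_2` are not conjugate in `G`. Such examples exist in abundance, and one good source of them is
`(G(𝔽_q), P_1(𝔽_q), P_2(𝔽_q))` where `G` is a reductive group over a finite field `𝔽_q`, with `P_1` and `P_2`
non-conjugate parabolic subgroups in `G` but for which their Levi subgroups are conjugate; the smallest such example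
is therefore for `G = SL_3(𝔽_2)`, a simple group of order `168` containing `P_1(𝔽_2)` and `P_2(𝔽_2)` as subgroups of
index `7`."  The marks are NOT computed by brute force over `168 × 168` conjugations: `m_{P₁}(g) = 24 · |{v ≠ 0 :
gv = v}|` and `m_{P₂}(g) = 24 · |{w ≠ 0 : wg = w}|` (§2, from the fibres of `x ↦ xe₀`, `x ↦ e₀x`), and the
fixed-vector counts of `g` and of its transpose agree (§1, `168 × 16` evaluations).  Everything is PROVED; the file
introduces NO definition and NO named fact (net Literature debt 0).

## Sources, verbatim

D. Prasad, *A refined notion of arithmetically equivalent number fields, and curves with isomorphic Jacobians*,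
Adv. Math. **312** (2017) 198–208 (arXiv 1409.3173, held text `paper:arxiv-1409.3173`), Introduction (p0002): "Call a
triple of finite groups `(G, H_1, H_2)` with `H_1` and `H_2` subgroups of `G`, a Gassmann triple, if `ℚ[G/H_1]` and
`ℚ[G/H_2]` are isomorphic as `G`-modules but `H_1` and `H_2` are not conjugate in `G`. Such examples exist in
abundance, and one good source of them is `(G(𝔽_q), P_1(𝔽_q), P_2(𝔽_q))` where `G` is a reductive group over a
finite field `𝔽_q`, with `P_1` and `P_2` non-conjugate parabolic subgroups in `G` but for which their Levi subgroups
are conjugate; the smallest such example is therefore for `G = SL_3(𝔽_2)`, a simple group of order `168` containing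
`P_1(𝔽_2)` and `P_2(𝔽_2)` as subgroups of index `7`. […] It is known that two number fields `K_1` and `K_2` have the
same zeta functions if and only if they have the same Galois closure over `ℚ`, with Galois group `G`, and are obtained
as fixed fields of subgroups `H_1` and `H_2` of `G` such that `(G, H_1, H_2)` forms a Gassmann triple. […] Given the
analogy between class groups and the Jacobian of projective algebraic curves, it is natural that the same ideas give
a general construction of curves with isomorphic Jacobians."

D. Prasad, C. S. Rajan, *On an archimedean analogue of Tate's conjecture*, J. Number Theory **99** (2003),
arXiv:math/0203295 (held `paper:arxiv-math_0203295`), §2: Gassmann equivalence "`|C ∩ H_1| = |C ∩ H_2|` for all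
conjugacy classes `C`", Cor. 4 (the Jacobians of `X/H_1`, `X/H_2` are isogenous).  V. Dokchitser, H. Green,
A. Konstantinou, A. Morgan, arXiv 2211.06357 §1.3 Thm. 1.3 (= Kani–Rosen, Math. Ann. 284 (1989), Thm. 3): "For every
Brauer relation `Θ = Σ_i H_i − Σ_j H_j'` for `G`, there is an isogeny `∏_j Jac_{X/H_j'} → ∏_i Jac_{X/H_i}`" (here
`Θ = P₁ − P₂`).

## Dictionary and what is proved

`G = SL₃(𝔽₂) = Matrix.SpecialLinearGroup (Fin 3) (ZMod 2)` (`= GL₃(𝔽₂) ≅ PSL₂(𝔽₇)`, order `168`), acting on `X` by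
`ρ : G →* End X`; `e₀ = (1,0,0)`; `P₁ = {A : A e₀ = e₀}` (the stabiliser of the POINT `e₀`, i.e. of the column vector;
e.g. Mathlib's `MulAction.stabilizer G e₀`, `mem_stabilizer_vec_iff`) and `P₂ = {A : e₀A = e₀}` (the stabiliser of the
row covector `e₀`, i.e. of the HYPERPLANE `{v : v₀ = 0}`) — the two maximal parabolics, each of order `24` and index
`7`, taken by MEMBERSHIP CHARACTERISATIONS; `N_i` with `End.of N_i = Σ_{h ∈ P_i} ρ h`, `B_{P_i} = Im N_i`.

* §1 (namespace `…SpecialLinearThreeTwo`, `decide +kernel`, ≈ 20 s in all): `card_filter_mulVec_eq`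
  (`|{x : xe₀ = v}| = 24·[v ≠ 0]`: `G` is transitive on the `7` non-zero vectors), `card_filter_vecMul_eq` (rows),
  **`card_fixedVectors_eq_card_fixedCovectors`** (`|{v ≠ 0 : gv = v}| = |{w ≠ 0 : wg = w}|` for all `168` `g` — the
  rank of `g − 1` equals that of its transpose), `exists_fix_vec_move_covec` (for every `w ≠ 0` some `h ∈ P₁` moves
  `w`: no hyperplane is fixed by all of `P₁`), `card_eq` (`|G| = 168`).
* §2 (group lemmas; the conjugation criteria for general `SLₙ(R)`): **`conj_mem_iff_mulVec`**
  (`x⁻¹gx ∈ P₁ ↔ g(xe₀) = xe₀`), **`mul_conj_mem_iff_vecMul`** (`xgx⁻¹ ∈ P₂ ↔ (e₀x)g = e₀x`),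
  `card_conj_mem_eq_card_mul_conj_mem` (`x ↦ x⁻¹`), `natCard_pointStabilizer` / `natCard_hyperplaneStabilizer`
  (`|P₁| = |P₂| = 24`), **`card_conj_mem_pointStabilizer`** (`m_{P₁}(g) = 24·|{v ≠ 0 : gv = v}|`),
  **`card_conj_mem_hyperplaneStabilizer`** (`m_{P₂}(g) = 24·|{w ≠ 0 : wg = w}|`), **`card_conj_mem_parabolic_eq`**
  (`m_{P₁} = m_{P₂}`: "`ℚ[G/H_1]` and `ℚ[G/H_2]` are isomorphic"), **`parabolic_not_conjugate`** (for every `x` some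
  `h ∈ P₁` has `xhx⁻¹ ∉ P₂`: "not conjugate in `G`"), `mem_stabilizer_vec_iff`, `exists_subgroup_vecMul_eq`
  (both parabolics exist as subgroups: Mathlib's stabiliser, and an explicit row stabiliser).
* §3 (any field) **`finrank_hom_image_parabolic_eq`** (`rk Hom(B_{P₁}, B) = rk Hom(B_{P₂}, B)` for all `B`);
  (perfect field) **`isIsogenous_parabolic`** (`B_{P₁} ∼ B_{P₂}` — for a curve `C̃` with `SL₃(𝔽₂)`-action the
  Jacobians of the two degree-`7` quotients `C̃/P₁`, `C̃/P₂` by the non-conjugate parabolics are isogenous, the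
  isogeny-level shadow of "construction of curves which are not isomorphic but whose Jacobians are"),
  **`dim_parabolic_eq`**, and `isIsogenous_parabolic_stabilizer` (with `P₁ = MulAction.stabilizer G e₀`).

Scope (stated, not hidden). (1) Only the rational statement (isogeny `B_{P₁} ∼ B_{P₂}`, equal Hom counts and
dimensions) is formalised — Prasad's REFINED (integral, `ℤ[G/H_1] ≅ ℤ[G/H_2]`) equivalence and the resulting
ISOMORPHISM of Jacobians (L. Scott's triple) are not.  (2) `P₁`, `P₂` are taken by membership predicates on
`Matrix.SpecialLinearGroup (Fin 3) (ZMod 2)`; the identification `SL₃(𝔽₂) = GL₃(𝔽₂) ≅ PSL₂(𝔽₇)` and the general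
parabolic statement for `G(𝔽_q)` are not formalised.  (3) Hom counts over ANY field; isogeny and dimensions over a
PERFECT field.

## References

* [Prasad2017] D. Prasad, Adv. Math. 312 (2017) 198–208, arXiv:1409.3173, Introduction (Gassmann triples;
  `(SL_3(𝔽_2), P_1, P_2)`).
* [PrasadRajan2003] D. Prasad, C. S. Rajan, J. Number Theory 99 (2003), arXiv:math/0203295, §2, Cor. 4.
* [KaniRosen1989] E. Kani, M. Rosen, Math. Ann. 284 (1989) 307–327, Thm. 3.
* [DokchitserEtAl2022] V. Dokchitser, H. Green, A. Konstantinou, A. Morgan, arXiv:2211.06357, §1.3 Thm. 1.3.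
* [BartelDokchitser2015] A. Bartel, T. Dokchitser, JEMS 17 (2015), §1 (Brauer relations `H₁ − H₂`).
-/

noncomputable section

universe u

open CategoryTheory CategoryTheory.Limits Matrix

namespace Literature.AlgebraicGeometry.Motives

/-! ## §1 The finite computations in `SL₃(𝔽₂)` — machine-checked -/

namespace SpecialLinearThreeTwo

set_option maxHeartbeats 4000000 in
/-- **`SL₃(𝔽₂)` is transitive on the `7` non-zero vectors, with stabilisers of order `24`**: for every
`v ∈ 𝔽₂³`, `|{x ∈ SL₃(𝔽₂) : x e₀ = v}| = 24` if `v ≠ 0` and `= 0` if `v = 0` (`e₀ = (1,0,0)`).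
[cite: Prasad2017, Introduction (P_1(𝔽_2) ≤ SL_3(𝔽_2) of index 7)] -/
theorem card_filter_mulVec_eq : ∀ v : Fin 3 → ZMod 2,
    (Finset.univ.filter fun x : Matrix.SpecialLinearGroup (Fin 3) (ZMod 2) ↦
        (x : Matrix (Fin 3) (Fin 3) (ZMod 2)) *ᵥ ![1, 0, 0] = v).card = if v = 0 then 0 else 24 := by
  decide +kernel

set_option maxHeartbeats 4000000 in
/-- **The same for row vectors**: `|{x ∈ SL₃(𝔽₂) : e₀ x = w}| = 24` if `w ≠ 0`, `= 0` if `w = 0`.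
[cite: Prasad2017, Introduction (P_2(𝔽_2) ≤ SL_3(𝔽_2) of index 7)] -/
theorem card_filter_vecMul_eq : ∀ w : Fin 3 → ZMod 2,
    (Finset.univ.filter fun x : Matrix.SpecialLinearGroup (Fin 3) (ZMod 2) ↦
        ![1, 0, 0] ᵥ* (x : Matrix (Fin 3) (Fin 3) (ZMod 2)) = w).card = if w = 0 then 0 else 24 := by
  decide +kernel

set_option maxHeartbeats 4000000 in
/-- **Every `g ∈ SL₃(𝔽₂)` fixes as many non-zero vectors as non-zero covectors** (`rank(g − 1) = rank(gᵀ − 1)`),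
machine-checked over the `168` elements: `|{v ≠ 0 : gv = v}| = |{w ≠ 0 : wg = w}|` — the permutation characters of
`SL₃(𝔽₂)` on points and on hyperplanes of `ℙ²(𝔽₂)` coincide.
[cite: Prasad2017, Introduction ("ℚ[G/H_1] and ℚ[G/H_2] are isomorphic as G-modules")] -/
theorem card_fixedVectors_eq_card_fixedCovectors : ∀ g : Matrix.SpecialLinearGroup (Fin 3) (ZMod 2),
    (Finset.univ.filter fun v : Fin 3 → ZMod 2 ↦ v ≠ 0 ∧ (g : Matrix (Fin 3) (Fin 3) (ZMod 2)) *ᵥ v = v).card =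
      (Finset.univ.filter fun w : Fin 3 → ZMod 2 ↦ w ≠ 0 ∧ w ᵥ* (g : Matrix (Fin 3) (Fin 3) (ZMod 2)) = w).card := by
  decide +kernel

set_option maxHeartbeats 4000000 in
/-- **No hyperplane is fixed by the whole point stabiliser**: for every non-zero covector `w` some `h` with
`h e₀ = e₀` has `wh ≠ w` (so `P₁` and `P₂` are not conjugate, §2).
[cite: Prasad2017, Introduction ("H_1 and H_2 are not conjugate in G")] -/
theorem exists_fix_vec_move_covec : ∀ w : Fin 3 → ZMod 2, w ≠ 0 →
    ∃ h : Matrix.SpecialLinearGroup (Fin 3) (ZMod 2),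
      (h : Matrix (Fin 3) (Fin 3) (ZMod 2)) *ᵥ ![1, 0, 0] = ![1, 0, 0] ∧
        w ᵥ* (h : Matrix (Fin 3) (Fin 3) (ZMod 2)) ≠ w := by
  decide +kernel

set_option maxHeartbeats 4000000 in
/-- `|SL₃(𝔽₂)| = 168`. [cite: Prasad2017, Introduction ("a simple group of order 168")] -/
theorem card_eq : Fintype.card (Matrix.SpecialLinearGroup (Fin 3) (ZMod 2)) = 168 := by
  decide +kernel

end SpecialLinearThreeTwo

namespace AbelianVariety

/-! ## §2 The marks of the two parabolics: `m_{P₁}(g) = 24·|Fix(g)∖0| = 24·|Fix(gᵀ)∖0| = m_{P₂}(g)` -/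

section ParabolicMarks

open SpecialLinearThreeTwo

/-- **Conjugates in a vector stabiliser** (any `SLₙ(R)`): if `A ∈ P ↔ A v₀ = v₀`, then
`x⁻¹gx ∈ P ↔ g(xv₀) = xv₀`. [cite: PrasadRajan2003, §2 (Gassmann equivalence via G-sets)] -/
theorem conj_mem_iff_mulVec {n : Type} [Fintype n] [DecidableEq n] {R : Type} [CommRing R]
    (P : Subgroup (Matrix.SpecialLinearGroup n R)) (v₀ : n → R)
    (hP : ∀ A : Matrix.SpecialLinearGroup n R, A ∈ P ↔ (A : Matrix n n R) *ᵥ v₀ = v₀)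
    (g x : Matrix.SpecialLinearGroup n R) :
    x⁻¹ * g * x ∈ P ↔ (g : Matrix n n R) *ᵥ ((x : Matrix n n R) *ᵥ v₀) = (x : Matrix n n R) *ᵥ v₀ := by
  have hx : (x : Matrix n n R) * ((x⁻¹ : Matrix.SpecialLinearGroup n R) : Matrix n n R) = 1 := by
    rw [← Matrix.SpecialLinearGroup.coe_mul, mul_inv_cancel, Matrix.SpecialLinearGroup.coe_one]
  have hx' : ((x⁻¹ : Matrix.SpecialLinearGroup n R) : Matrix n n R) * (x : Matrix n n R) = 1 := by
    rw [← Matrix.SpecialLinearGroup.coe_mul, inv_mul_cancel, Matrix.SpecialLinearGroup.coe_one]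
  rw [hP, Matrix.SpecialLinearGroup.coe_mul, Matrix.SpecialLinearGroup.coe_mul, Matrix.mulVec_mulVec]
  constructor
  · intro h
    have h' := congrArg (fun w ↦ (x : Matrix n n R) *ᵥ w) h
    simp only [Matrix.mulVec_mulVec, ← mul_assoc, hx, one_mul] at h'
    exact h'
  · intro h
    have h' := congrArg (fun w ↦ ((x⁻¹ : Matrix.SpecialLinearGroup n R) : Matrix n n R) *ᵥ w) h
    simp only [Matrix.mulVec_mulVec, ← mul_assoc, hx', Matrix.one_mulVec] at h'
    exact h'

/-- **Conjugates in a covector stabiliser** (any `SLₙ(R)`): if `A ∈ P ↔ w₀ A = w₀`, then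
`xgx⁻¹ ∈ P ↔ (w₀x) g = w₀x`. [cite: PrasadRajan2003, §2 (Gassmann equivalence via G-sets)] -/
theorem mul_conj_mem_iff_vecMul {n : Type} [Fintype n] [DecidableEq n] {R : Type} [CommRing R]
    (P : Subgroup (Matrix.SpecialLinearGroup n R)) (w₀ : n → R)
    (hP : ∀ A : Matrix.SpecialLinearGroup n R, A ∈ P ↔ w₀ ᵥ* (A : Matrix n n R) = w₀)
    (g x : Matrix.SpecialLinearGroup n R) :
    x * g * x⁻¹ ∈ P ↔ (w₀ ᵥ* (x : Matrix n n R)) ᵥ* (g : Matrix n n R) = w₀ ᵥ* (x : Matrix n n R) := by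
  have hx : (x : Matrix n n R) * ((x⁻¹ : Matrix.SpecialLinearGroup n R) : Matrix n n R) = 1 := by
    rw [← Matrix.SpecialLinearGroup.coe_mul, mul_inv_cancel, Matrix.SpecialLinearGroup.coe_one]
  have hx' : ((x⁻¹ : Matrix.SpecialLinearGroup n R) : Matrix n n R) * (x : Matrix n n R) = 1 := by
    rw [← Matrix.SpecialLinearGroup.coe_mul, inv_mul_cancel, Matrix.SpecialLinearGroup.coe_one]
  rw [hP, Matrix.SpecialLinearGroup.coe_mul, Matrix.SpecialLinearGroup.coe_mul, Matrix.vecMul_vecMul]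
  constructor
  · intro h
    have h' := congrArg (fun w ↦ w ᵥ* (x : Matrix n n R)) h
    simp only [Matrix.vecMul_vecMul, mul_assoc, hx', mul_one] at h'
    exact h'
  · intro h
    have h' := congrArg (fun w ↦ w ᵥ* ((x⁻¹ : Matrix.SpecialLinearGroup n R) : Matrix n n R)) h
    simp only [Matrix.vecMul_vecMul, mul_assoc, hx, Matrix.vecMul_one] at h'
    rw [← mul_assoc] at h'
    exact h'

/-- `x ↦ x⁻¹` exchanges the two conjugation counts: `|{x : x⁻¹gx ∈ H}| = |{x : xgx⁻¹ ∈ H}|`. [folklore] -/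
private theorem card_conj_mem_eq_card_mul_conj_mem {G : Type} [Group G] (H : Subgroup G) (g : G) :
    Nat.card {x : G // x⁻¹ * g * x ∈ H} = Nat.card {x : G // x * g * x⁻¹ ∈ H} :=
  Nat.card_congr (Equiv.subtypeEquiv (Equiv.inv G) fun x ↦ by rw [Equiv.inv_apply, inv_inv])

/-- Transfer of counts to decidable predicates. [folklore] -/
private theorem natCard_subtype_eq_card_filter {α : Type} [Fintype α] (P : α → Prop) [DecidablePred P]
    (Q : α → Prop) (hQP : ∀ x, Q x ↔ P x) : Nat.card {x : α // Q x} = (Finset.univ.filter P).card := by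
  rw [← Fintype.card_subtype, ← Nat.card_eq_fintype_card]
  exact Nat.card_congr (Equiv.subtypeEquivRight hQP)

/-- Counting through a map, fibre by fibre: `|{a : Q(φ a)}| = Σ_{b : Q b} |{a : φ a = b}|`. [folklore] -/
private theorem card_filter_comp_eq_sum {α β : Type} [Fintype α] [Fintype β] [DecidableEq β] (φ : α → β)
    (Q : β → Prop) [DecidablePred Q] :
    (Finset.univ.filter fun a ↦ Q (φ a)).card =
      ∑ b ∈ Finset.univ.filter Q, (Finset.univ.filter fun a ↦ φ a = b).card := by
  rw [Finset.card_eq_sum_card_fiberwise (f := φ) (s := Finset.univ.filter fun a ↦ Q (φ a))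
    (t := Finset.univ.filter Q) fun a ha ↦ by
      simp only [Finset.coe_filter, Finset.mem_univ, true_and, Set.mem_setOf_eq] at ha ⊢
      exact ha]
  refine Finset.sum_congr rfl fun b hb ↦ ?_
  have hb' : Q b := (Finset.mem_filter.1 hb).2
  congr 1
  ext a
  simp only [Finset.mem_filter, Finset.mem_univ, true_and]
  exact ⟨fun h ↦ h.2, fun h ↦ ⟨by rw [h]; exact hb', h⟩⟩

/-- Summing the fibre sizes `24·[v ≠ 0]` over a set of vectors. [folklore] -/
private theorem sum_ite_eq_mul_card (S : Finset (Fin 3 → ZMod 2)) :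
    ∑ v ∈ S, (if v = 0 then 0 else 24) = 24 * (S.filter fun v ↦ v ≠ 0).card := by
  rw [Finset.sum_ite, Finset.sum_const_zero, zero_add, Finset.sum_const, smul_eq_mul, mul_comm]

variable (P₁ P₂ : Subgroup (Matrix.SpecialLinearGroup (Fin 3) (ZMod 2)))

/-- **`|P₁| = 24`** (index `7` in `SL₃(𝔽₂)`): the stabiliser of `e₀ = (1,0,0)`.
[cite: Prasad2017, Introduction ("subgroups of index 7")] -/
theorem natCard_pointStabilizer
    (hP₁ : ∀ A, A ∈ P₁ ↔ (A : Matrix (Fin 3) (Fin 3) (ZMod 2)) *ᵥ ![1, 0, 0] = ![1, 0, 0]) :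
    Nat.card P₁ = 24 := by
  rw [show Nat.card P₁ = Nat.card {x : Matrix.SpecialLinearGroup (Fin 3) (ZMod 2) // x ∈ P₁} from rfl,
    natCard_subtype_eq_card_filter _ _ hP₁, card_filter_mulVec_eq, if_neg (by decide)]

/-- **`|P₂| = 24`**: the stabiliser of the covector `e₀` (of the hyperplane `v₀ = 0`).
[cite: Prasad2017, Introduction ("subgroups of index 7")] -/
theorem natCard_hyperplaneStabilizer
    (hP₂ : ∀ A, A ∈ P₂ ↔ ![1, 0, 0] ᵥ* (A : Matrix (Fin 3) (Fin 3) (ZMod 2)) = ![1, 0, 0]) :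
    Nat.card P₂ = 24 := by
  rw [show Nat.card P₂ = Nat.card {x : Matrix.SpecialLinearGroup (Fin 3) (ZMod 2) // x ∈ P₂} from rfl,
    natCard_subtype_eq_card_filter _ _ hP₂, card_filter_vecMul_eq, if_neg (by decide)]

/-- **The marks of the point stabiliser**: `m_{P₁}(g) = |{x : x⁻¹gx ∈ P₁}| = 24 · |{v ≠ 0 : gv = v}|` (sort the
`x` by the non-zero vector `xe₀`, each value taken `24` times). [cite: PrasadRajan2003, §2] [cite: Prasad2017, Introduction] -/
theorem card_conj_mem_pointStabilizer
    (hP₁ : ∀ A, A ∈ P₁ ↔ (A : Matrix (Fin 3) (Fin 3) (ZMod 2)) *ᵥ ![1, 0, 0] = ![1, 0, 0])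
    (g : Matrix.SpecialLinearGroup (Fin 3) (ZMod 2)) :
    Nat.card {x : Matrix.SpecialLinearGroup (Fin 3) (ZMod 2) // x⁻¹ * g * x ∈ P₁} =
      24 * (Finset.univ.filter fun v : Fin 3 → ZMod 2 ↦
        v ≠ 0 ∧ (g : Matrix (Fin 3) (Fin 3) (ZMod 2)) *ᵥ v = v).card := by
  rw [natCard_subtype_eq_card_filter (fun x : Matrix.SpecialLinearGroup (Fin 3) (ZMod 2) ↦
      (g : Matrix (Fin 3) (Fin 3) (ZMod 2)) *ᵥ ((x : Matrix (Fin 3) (Fin 3) (ZMod 2)) *ᵥ ![1, 0, 0]) =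
        (x : Matrix (Fin 3) (Fin 3) (ZMod 2)) *ᵥ ![1, 0, 0]) _ (conj_mem_iff_mulVec P₁ _ hP₁ g),
    card_filter_comp_eq_sum (fun x : Matrix.SpecialLinearGroup (Fin 3) (ZMod 2) ↦
      (x : Matrix (Fin 3) (Fin 3) (ZMod 2)) *ᵥ ![1, 0, 0])
      (fun v ↦ (g : Matrix (Fin 3) (Fin 3) (ZMod 2)) *ᵥ v = v),
    Finset.sum_congr rfl fun v _ ↦ card_filter_mulVec_eq v, sum_ite_eq_mul_card, Finset.filter_filter]
  congr 2
  exact Finset.filter_congr fun v _ ↦ and_comm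

/-- **The marks of the hyperplane stabiliser**: `m_{P₂}(g) = |{x : x⁻¹gx ∈ P₂}| = |{x : xgx⁻¹ ∈ P₂}| =
24 · |{w ≠ 0 : wg = w}|` (sort the `x` by the non-zero covector `e₀x`). [cite: PrasadRajan2003, §2] [cite: Prasad2017, Introduction] -/
theorem card_conj_mem_hyperplaneStabilizer
    (hP₂ : ∀ A, A ∈ P₂ ↔ ![1, 0, 0] ᵥ* (A : Matrix (Fin 3) (Fin 3) (ZMod 2)) = ![1, 0, 0])
    (g : Matrix.SpecialLinearGroup (Fin 3) (ZMod 2)) :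
    Nat.card {x : Matrix.SpecialLinearGroup (Fin 3) (ZMod 2) // x⁻¹ * g * x ∈ P₂} =
      24 * (Finset.univ.filter fun w : Fin 3 → ZMod 2 ↦
        w ≠ 0 ∧ w ᵥ* (g : Matrix (Fin 3) (Fin 3) (ZMod 2)) = w).card := by
  rw [card_conj_mem_eq_card_mul_conj_mem,
    natCard_subtype_eq_card_filter (fun x : Matrix.SpecialLinearGroup (Fin 3) (ZMod 2) ↦
      (![1, 0, 0] ᵥ* (x : Matrix (Fin 3) (Fin 3) (ZMod 2))) ᵥ* (g : Matrix (Fin 3) (Fin 3) (ZMod 2)) =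
        ![1, 0, 0] ᵥ* (x : Matrix (Fin 3) (Fin 3) (ZMod 2))) _ (mul_conj_mem_iff_vecMul P₂ _ hP₂ g),
    card_filter_comp_eq_sum (fun x : Matrix.SpecialLinearGroup (Fin 3) (ZMod 2) ↦
      ![1, 0, 0] ᵥ* (x : Matrix (Fin 3) (Fin 3) (ZMod 2)))
      (fun w ↦ w ᵥ* (g : Matrix (Fin 3) (Fin 3) (ZMod 2)) = w),
    Finset.sum_congr rfl fun w _ ↦ card_filter_vecMul_eq w, sum_ite_eq_mul_card, Finset.filter_filter]
  congr 2
  exact Finset.filter_congr fun w _ ↦ and_comm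

/-- **`(SL₃(𝔽₂), P₁, P₂)` is Gassmann: equal marks**, `|{x : x⁻¹gx ∈ P₁}| = |{x : x⁻¹gx ∈ P₂}|` for all `g` — the
permutation representations `ℚ[G/P₁]` (points of `ℙ²(𝔽₂)`) and `ℚ[G/P₂]` (lines) are isomorphic.
[cite: Prasad2017, Introduction] [cite: PrasadRajan2003, §2] -/
theorem card_conj_mem_parabolic_eq
    (hP₁ : ∀ A, A ∈ P₁ ↔ (A : Matrix (Fin 3) (Fin 3) (ZMod 2)) *ᵥ ![1, 0, 0] = ![1, 0, 0])
    (hP₂ : ∀ A, A ∈ P₂ ↔ ![1, 0, 0] ᵥ* (A : Matrix (Fin 3) (Fin 3) (ZMod 2)) = ![1, 0, 0])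
    (g : Matrix.SpecialLinearGroup (Fin 3) (ZMod 2)) :
    Nat.card {x : Matrix.SpecialLinearGroup (Fin 3) (ZMod 2) // x⁻¹ * g * x ∈ P₁} =
      Nat.card {x : Matrix.SpecialLinearGroup (Fin 3) (ZMod 2) // x⁻¹ * g * x ∈ P₂} := by
  rw [card_conj_mem_pointStabilizer P₁ hP₁, card_conj_mem_hyperplaneStabilizer P₂ hP₂,
    card_fixedVectors_eq_card_fixedCovectors]

/-- **`P₁` and `P₂` are not conjugate**: for every `x ∈ SL₃(𝔽₂)` some `h ∈ P₁` has `xhx⁻¹ ∉ P₂` (the covector `e₀x`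
is moved by some element of `P₁`). [cite: Prasad2017, Introduction ("P_1 and P_2 non-conjugate parabolic subgroups")] -/
theorem parabolic_not_conjugate
    (hP₁ : ∀ A, A ∈ P₁ ↔ (A : Matrix (Fin 3) (Fin 3) (ZMod 2)) *ᵥ ![1, 0, 0] = ![1, 0, 0])
    (hP₂ : ∀ A, A ∈ P₂ ↔ ![1, 0, 0] ᵥ* (A : Matrix (Fin 3) (Fin 3) (ZMod 2)) = ![1, 0, 0])
    (x : Matrix.SpecialLinearGroup (Fin 3) (ZMod 2)) : ∃ h ∈ P₁, x * h * x⁻¹ ∉ P₂ := by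
  have hw : ![1, 0, 0] ᵥ* (x : Matrix (Fin 3) (Fin 3) (ZMod 2)) ≠ 0 := by
    intro h0
    have h1 : ![1, 0, 0] ᵥ* ((x : Matrix (Fin 3) (Fin 3) (ZMod 2)) *
        ((x⁻¹ : Matrix.SpecialLinearGroup (Fin 3) (ZMod 2)) : Matrix (Fin 3) (Fin 3) (ZMod 2))) = 0 := by
      rw [← Matrix.vecMul_vecMul, h0, Matrix.zero_vecMul]
    rw [← Matrix.SpecialLinearGroup.coe_mul, mul_inv_cancel, Matrix.SpecialLinearGroup.coe_one,
      Matrix.vecMul_one] at h1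
    have h2 := congrFun h1 0
    simp at h2
  obtain ⟨h, hh₁, hh₂⟩ := exists_fix_vec_move_covec _ hw
  exact ⟨h, (hP₁ h).2 hh₁, fun hmem ↦ hh₂ ((mul_conj_mem_iff_vecMul P₂ _ hP₂ h x).1 hmem)⟩

/-- **The point stabiliser is Mathlib's `MulAction.stabilizer`**: `A ∈ Stab(e₀) ↔ A e₀ = e₀` (the action of
`SpecialLinearGroup` on vectors is `A • v = A *ᵥ v`). [cite: Prasad2017, Introduction] -/
theorem mem_stabilizer_vec_iff (A : Matrix.SpecialLinearGroup (Fin 3) (ZMod 2)) :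
    A ∈ MulAction.stabilizer (Matrix.SpecialLinearGroup (Fin 3) (ZMod 2)) (![1, 0, 0] : Fin 3 → ZMod 2) ↔
      (A : Matrix (Fin 3) (Fin 3) (ZMod 2)) *ᵥ ![1, 0, 0] = ![1, 0, 0] :=
  MulAction.mem_stabilizer_iff

/-- **The hyperplane stabiliser exists as a subgroup**: there is `P₂ ≤ SL₃(𝔽₂)` with `A ∈ P₂ ↔ e₀A = e₀`.
[cite: Prasad2017, Introduction] -/
theorem exists_subgroup_vecMul_eq : ∃ P : Subgroup (Matrix.SpecialLinearGroup (Fin 3) (ZMod 2)),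
    ∀ A, A ∈ P ↔ ![1, 0, 0] ᵥ* (A : Matrix (Fin 3) (Fin 3) (ZMod 2)) = ![1, 0, 0] := by
  refine ⟨{ carrier := {A | ![1, 0, 0] ᵥ* (A : Matrix (Fin 3) (Fin 3) (ZMod 2)) = ![1, 0, 0]}
            mul_mem' := fun {A B} hA hB ↦ ?_
            one_mem' := ?_
            inv_mem' := fun {A} hA ↦ ?_ }, fun A ↦ Iff.rfl⟩
  · simp only [Set.mem_setOf_eq] at hA hB ⊢
    rw [Matrix.SpecialLinearGroup.coe_mul, ← Matrix.vecMul_vecMul, hA, hB]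
  · simp only [Set.mem_setOf_eq, Matrix.SpecialLinearGroup.coe_one, Matrix.vecMul_one]
  · simp only [Set.mem_setOf_eq] at hA ⊢
    have h := congrArg (fun w ↦ w ᵥ* ((A⁻¹ : Matrix.SpecialLinearGroup (Fin 3) (ZMod 2)) :
      Matrix (Fin 3) (Fin 3) (ZMod 2))) hA
    simp only [Matrix.vecMul_vecMul, ← Matrix.SpecialLinearGroup.coe_mul, mul_inv_cancel,
      Matrix.SpecialLinearGroup.coe_one, Matrix.vecMul_one] at h
    exact h.symm

end ParabolicMarks

/-! ## §3 `B_{P₁} ∼ B_{P₂}` for every abelian variety with an `SL₃(𝔽₂)`-action -/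

section ParabolicGassmann

variable {K : Type u} [Field K] {X : AbelianVariety K} (ρ : Matrix.SpecialLinearGroup (Fin 3) (ZMod 2) →* End X)
  (P₁ P₂ : Subgroup (Matrix.SpecialLinearGroup (Fin 3) (ZMod 2))) [Fintype P₁] [Fintype P₂] {N₁ N₂ : X ⟶ X}

/-- **Equal Hom counts for the two parabolics** (any field): for an action of `SL₃(𝔽₂)` on `X`, the point stabiliser
`P₁` (`A ∈ P₁ ↔ Ae₀ = e₀`), the hyperplane stabiliser `P₂` (`A ∈ P₂ ↔ e₀A = e₀`) and every `B`:
**`rk Hom(B_{P₁}, B) = rk Hom(B_{P₂}, B)`** (`finrank_hom_image_eq_of_gassmann` fed with the machine-checked marks).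
[cite: Prasad2017, Introduction] [cite: PrasadRajan2003, Cor. 4] [cite: KaniRosen1989, Thm. 3] -/
theorem finrank_hom_image_parabolic_eq
    (hP₁ : ∀ A, A ∈ P₁ ↔ (A : Matrix (Fin 3) (Fin 3) (ZMod 2)) *ᵥ ![1, 0, 0] = ![1, 0, 0])
    (hP₂ : ∀ A, A ∈ P₂ ↔ ![1, 0, 0] ᵥ* (A : Matrix (Fin 3) (Fin 3) (ZMod 2)) = ![1, 0, 0])
    (hN₁ : End.of N₁ = ∑ h : P₁, ρ h) (hN₂ : End.of N₂ = ∑ h : P₂, ρ h) (B : AbelianVariety K) :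
    Module.finrank ℤ (image N₁ ⟶ B) = Module.finrank ℤ (image N₂ ⟶ B) :=
  finrank_hom_image_eq_of_gassmann ρ P₁ P₂
    (card_isConj_eq_of_card_conj_mem_eq P₁ P₂ (card_conj_mem_parabolic_eq P₁ P₂ hP₁ hP₂)) hN₁ hN₂ B

variable [PerfectField K]

/-- **The parabolic Gassmann triple gives isogenous `B`'s** (perfect field): **`B_{P₁} ∼ B_{P₂}`** for every abelian
variety `X` with `SL₃(𝔽₂)`-action — for the Jacobian of a curve `C̃` with `SL₃(𝔽₂)`-action, the Jacobians of the two
degree-`7` quotients `C̃/P₁`, `C̃/P₂` by the NON-CONJUGATE parabolics are isogenous ("construction of a general class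
of curves which are not isomorphic but whose Jacobians are" — here: isogenous; the isogeny relation of the Brauer
relation `P₁ − P₂`). [cite: Prasad2017, Introduction] [cite: PrasadRajan2003, Cor. 4] [cite: KaniRosen1989, Thm. 3]
[cite: DokchitserEtAl2022, §1.3 Thm. 1.3] -/
theorem isIsogenous_parabolic
    (hP₁ : ∀ A, A ∈ P₁ ↔ (A : Matrix (Fin 3) (Fin 3) (ZMod 2)) *ᵥ ![1, 0, 0] = ![1, 0, 0])
    (hP₂ : ∀ A, A ∈ P₂ ↔ ![1, 0, 0] ᵥ* (A : Matrix (Fin 3) (Fin 3) (ZMod 2)) = ![1, 0, 0])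
    (hN₁ : End.of N₁ = ∑ h : P₁, ρ h) (hN₂ : End.of N₂ = ∑ h : P₂, ρ h) : IsIsogenous (image N₁) (image N₂) :=
  isIsogenous_of_card_conj_mem_eq ρ P₁ P₂ (card_conj_mem_parabolic_eq P₁ P₂ hP₁ hP₂) hN₁ hN₂

/-- **Dimensions: `dim B_{P₁} = dim B_{P₂}`** (perfect field; for Jacobians `g(C̃/P₁) = g(C̃/P₂)`).
[cite: Prasad2017, Introduction] [cite: PrasadRajan2003, Cor. 4] -/
theorem dim_parabolic_eq
    (hP₁ : ∀ A, A ∈ P₁ ↔ (A : Matrix (Fin 3) (Fin 3) (ZMod 2)) *ᵥ ![1, 0, 0] = ![1, 0, 0])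
    (hP₂ : ∀ A, A ∈ P₂ ↔ ![1, 0, 0] ᵥ* (A : Matrix (Fin 3) (Fin 3) (ZMod 2)) = ![1, 0, 0])
    (hN₁ : End.of N₁ = ∑ h : P₁, ρ h) (hN₂ : End.of N₂ = ∑ h : P₂, ρ h) : (image N₁).dim = (image N₂).dim :=
  (isIsogenous_parabolic ρ P₁ P₂ hP₁ hP₂ hN₁ hN₂).dim_eq

omit [Fintype P₁] in
/-- **The same with Mathlib's stabiliser as `P₁`**: `P₁ = MulAction.stabilizer SL₃(𝔽₂) e₀`, `P₂` any subgroup with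
`A ∈ P₂ ↔ e₀A = e₀` (such a subgroup exists, `exists_subgroup_vecMul_eq`): `B_{Stab(e₀)} ∼ B_{P₂}`.
[cite: Prasad2017, Introduction] [cite: KaniRosen1989, Thm. 3] -/
theorem isIsogenous_parabolic_stabilizer
    [Fintype (MulAction.stabilizer (Matrix.SpecialLinearGroup (Fin 3) (ZMod 2)) (![1, 0, 0] : Fin 3 → ZMod 2))]
    (hP₂ : ∀ A, A ∈ P₂ ↔ ![1, 0, 0] ᵥ* (A : Matrix (Fin 3) (Fin 3) (ZMod 2)) = ![1, 0, 0])
    (hN₁ : End.of N₁ = ∑ h : MulAction.stabilizer (Matrix.SpecialLinearGroup (Fin 3) (ZMod 2))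
      (![1, 0, 0] : Fin 3 → ZMod 2), ρ h)
    (hN₂ : End.of N₂ = ∑ h : P₂, ρ h) : IsIsogenous (image N₁) (image N₂) :=
  isIsogenous_parabolic ρ _ P₂ mem_stabilizer_vec_iff hP₂ hN₁ hN₂

end ParabolicGassmann

end AbelianVariety

end Literature.AlgebraicGeometry.Motives
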